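import Summits.BirchSwinnertonDyer.BirchSwinnertonDyer.Theorems.AlignedTransportAtTwoMainConjectureOfRankZeroBSDAtTwoFineRoadCycTorsion
import Summits.BirchSwinnertonDyer.BirchSwinnertonDyer.Theorems.AlignedTransportAtTwoMainConjectureOfRankZeroBSDAtTwoFineRoadLimDescent
import Literature.NumberTheory.EllipticCurves.SelmerCorankAssembly
import Literature.NumberTheory.EllipticCurves.PointDivisibilityProofs
import HarnessLib

/-!
# PERFECT DESCENT §3(v) in the kernel: from `E[2]`-coefficients to `E[2^∞]`-coefficients over `ℚ_∞` —
# `H¹(ℚ_∞, E[2]) ≅ H¹(ℚ_∞, E[2^∞])[2]` and `Sel₀(ℚ_∞, E[2]) ↪ Sel₀(ℚ_∞, E[2^∞])[2]` (the NECESSITY half of (v))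

Cell `bsd-f1-sign2`, WIDTH-5 attach seat `bsd-line-att-p5` (gen 4) on line `birth` of crux C2
stmt-BirchSwinnertonDyer-22298 `MainConjectureOfRankZeroBSDAtTwo`; the lead's FREE helper target (c2) of the note
PERFECT-DESCENT.md (att-p2 g4, §3 (v) «From `N` to `E[2^∞]`»; lead division 2026-08-28T04:46:58Z). A `--supports 22298 --as helper`
file. HONEST FRAMING: THEOREMS ONLY — no definition, no named fact, no `sorry`; BSD is NOT proved by any of this.

* §1 (any number field `K`, elliptic `W`, prime `p`, any `H ≤ Γ_K`; the coefficient map `ι : E[p] ↪ E[p^∞]` and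
  `ι_* : H¹(H, E[p]) → H¹(H, E[p^∞])` = `resH1Hom (id_H) ι`): `nsmul_coeffMap_eq_zero` (`p · ι_* = 0`),
  **`coeffMap_injective_of_fixedPoints`** (`E[p^∞]^H = 0 ⟹ ι_*` injective: a principal `ι ∘ z = ∂a` has `p·a ∈ E[p^∞]^H = 0`, so
  `a ∈ E[p]`), **`exists_coeffMap_eq_of_nsmul_eq_zero`** (`ι_*` hits every `p`-torsion class: `p φ = ∂a`, `a = p b`, `φ − ∂b` is
  `E[p]`-valued — the cocycle argument of the tree's `exists_torsionToPrimaryH1_eq`, for the subgroup `H`).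
* §2 (functoriality of Greenberg's local conditions in the coefficients): `ι_*` commutes with `resOfLe` and `conjH1`, hence
  carries `awayKer`, the fine `strictKer`, `infKer` and the strict / relaxed-at-`∞` fine Selmer groups with `E[p]`-coefficients
  INTO those with `E[p^∞]`-coefficients (`coeffMap_mem_strictSelmerGroupOver_fine`, `…RelaxedInf`).
* §3 (`K = ℚ`, `p = 2`, cyclotomic `κ`, no rational point of order `2`): `E(ℚ_∞)[2^∞] ⊆ E(ℚ(ζ_{2^∞}))[2^∞] = 0` (att-p4 g3
  `CycTorsion.fixedPoints_kerCyclotomicCharacter_geomPrimaryTorsion_eq_bot`) ⟹ **`coeffMap_injective_rat_two`** and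
  `range ι_* = H¹(ℚ_∞, E[2^∞])[2]`; **`finite_fineSelmer_twoCoeff_of_finite_twoTorsion`**: if `Sel₀(ℚ_∞, E[2^∞])[2]` is finite
  (statement (A)₂), the whole fine Selmer group `Sel₀(ℚ_∞, E[2])` with `E[2]`-coefficients is finite (= the lead's
  `Hom_{G_∞}(X_{Σ-cs}(ℚ(E[2])_∞), E[2])`, PERFECT-DESCENT §3 (ii)); relaxed-at-`∞` twin. The converse (cokernel of `ι_*` on Selmer
  groups ↪ `⊕_v E(ℚ_{∞,v})[2^∞]/2`) is NOT proved here.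

References: R. Greenberg, LNM 1716 (1999) §5 p. 114 (proof of Prop. 5.8: `H¹(·, E[p]) ↠ H¹(·, E[p^∞])[p]`); J.-P. Serre, *Galois
Cohomology* I §2; the lead's PERFECT-DESCENT.md §3 (v) (crux workfile, cell bsd-f1-sign2).
-/

set_option autoImplicit false
-- the Theorems namespace of this sub repeats the summit name by design (D-0017 nested layout)
set_option linter.dupNamespace false

noncomputable section

open scoped Classical

namespace Summit.BirchSwinnertonDyer.BirchSwinnertonDyer.Theorems.AlignedTransportAtTwoFineRoad.TorsionCoefficients

open WeierstrassCurve NumberField IsDedekindDomain Field Literature.NumberTheory.EllipticCurves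
  Literature.NumberTheory.EllipticCurves.GreenbergSelmer Literature.NumberTheory.GaloisRepresentations

universe u

/-! ## §1 The coefficient map `ι_* : H¹(H, E[p]) → H¹(H, E[p^∞])` on a subgroup `H ≤ Γ_K` -/

section Generic

variable {K : Type u} [Field K] (W : WeierstrassCurve K) (p : ℕ) [Fact p.Prime] (H : Subgroup (absoluteGaloisGroup K))

omit [Fact p.Prime] in
/-- `ι_* : H¹(H, E[p]) → H¹(H, E[p^∞])` lands in the `p`-torsion: `p · ι_*(c) = 0` (an `E[p]`-valued cocycle is killed by `p`).
[cite: GreenbergLNM1716, §5 p. 114 (proof of Prop. 5.8)] -/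
theorem nsmul_coeffMap_eq_zero (c : subgroupH1 H (geomTorsion W (p : ℤ))) :
    p • resH1Hom (ContinuousMonoidHom.id H) (AddSubgroup.inclusion (geomTorsion_le_geomPrimaryTorsion W p))
      (fun _ _ ↦ rfl) c = 0 := by
  obtain ⟨z, rfl⟩ := oneCocycleClass_surjective _ c
  rw [resH1Hom_id_oneCocycleClass]
  refine nsmul_oneCocycleClass_eq_zero _ p fun g ↦ ?_
  rw [contOneCocycles.push_apply, ← map_nsmul]
  have h0 : p • z.1 g = 0 := Subtype.ext (by
    rw [AddSubgroupClass.coe_nsmul, ZeroMemClass.coe_zero]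
    exact AddSubgroup.torsionBy.nsmul_iff.mp (z.1 g).2)
  rw [h0, map_zero]

omit [Fact p.Prime] in
/-- **`E[p^∞]^H = 0 ⟹ ι_* : H¹(H, E[p]) → H¹(H, E[p^∞])` is INJECTIVE.** If `ι ∘ z = ∂a` with `a ∈ E[p^∞]`, then
`∂(p·a) = p·(ι ∘ z) = 0`, so `p·a` is `H`-fixed, hence `0`; thus `a ∈ E[p]` and `z = ∂a` already in `E[p]`. (The kernel of `ι_*`
is `E[p^∞]^H/p` in general.) [cite: GreenbergLNM1716, §5 p. 114 (proof of Prop. 5.8: «with finite kernel»)] -/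
theorem coeffMap_injective_of_fixedPoints
    (hfix : ∀ m : W.geomPrimaryTorsion p, (∀ h : H, h • m = m) → m = 0) :
    Function.Injective (resH1Hom (ContinuousMonoidHom.id H)
      (AddSubgroup.inclusion (geomTorsion_le_geomPrimaryTorsion W p)) (fun _ _ ↦ rfl) :
        subgroupH1 H (geomTorsion W (p : ℤ)) →+ subgroupH1 H (W.geomPrimaryTorsion p)) := by
  rw [injective_iff_map_eq_zero]
  intro c hc
  obtain ⟨z, rfl⟩ := oneCocycleClass_surjective _ c
  obtain ⟨a, ha⟩ := (CocycleCriteria.resH1Hom_oneCocycleClass_eq_zero_iff _ _ _ z).mp hc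
  -- `p • a` is `H`-fixed, hence zero
  have hpa : ∀ h : H, h • (p • a) = p • a := fun h ↦ by
    have e := ha h
    have h0 : p • z.1 (ContinuousMonoidHom.id H h) = 0 := Subtype.ext (by
      rw [AddSubgroupClass.coe_nsmul, ZeroMemClass.coe_zero]
      exact AddSubgroup.torsionBy.nsmul_iff.mp (z.1 _).2)
    have e2 := congrArg (fun m ↦ p • m) e
    simp only at e2
    rw [← map_nsmul, h0, map_zero, smul_sub, smul_comm p h a, eq_comm, sub_eq_zero] at e2
    exact e2
  have hpa0 : p • a = 0 := hfix _ hpa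
  -- so `a ∈ E[p]` and `z` is the coboundary of `a` inside `E[p]`
  have ha' : (a : geomPoints W) ∈ geomTorsion W (p : ℤ) :=
    AddSubgroup.torsionBy.nsmul_iff.mpr (by rw [← AddSubgroupClass.coe_nsmul, hpa0, ZeroMemClass.coe_zero])
  refine (oneCocycleClass_eq_zero_iff _ z).mpr ⟨⟨(a : geomPoints W), ha'⟩, fun h ↦ ?_⟩
  apply AddSubgroup.inclusion_injective (geomTorsion_le_geomPrimaryTorsion W p)
  rw [discreteTopRep_ρ_apply, map_sub]
  exact ha h

variable [W.IsElliptic]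

/-- **`ι_* : H¹(H, E[p]) → H¹(H, E[p^∞])` hits every `p`-torsion class** (`E(K̄)` is divisible: if `p[φ] = 0` then `p φ = ∂a`,
`a = p b` in `E[p^∞]`, and `φ − ∂b` is `E[p]`-valued) — the cocycle argument of the tree's `exists_torsionToPrimaryH1_eq`, run for the
subgroup `H`. [cite: GreenbergLNM1716, §5 p. 114 (proof of Prop. 5.8)] -/
theorem exists_coeffMap_eq_of_nsmul_eq_zero {x : subgroupH1 H (W.geomPrimaryTorsion p)} (hx : p • x = 0) :
    ∃ y : subgroupH1 H (geomTorsion W (p : ℤ)),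
      resH1Hom (ContinuousMonoidHom.id H) (AddSubgroup.inclusion (geomTorsion_le_geomPrimaryTorsion W p))
        (fun _ _ ↦ rfl) y = x := by
  have hdiv : W.zsmul_geomPoints_surjective := W.zsmul_geomPoints_surjective_holds
  obtain ⟨φ, rfl⟩ := oneCocycleClass_surjective _ x
  have h := oneCocycleClass_smul (discreteTopRep H (W.geomPrimaryTorsion p)) (p : ℤ) φ
  conv at h => rhs; rw [Nat.cast_smul_eq_nsmul, hx]
  obtain ⟨a, ha⟩ := (oneCocycleClass_eq_zero_iff _ _).mp h
  have ha' : ∀ σ : H, p • φ.1 σ = (σ : absoluteGaloisGroup K) • a - a := fun σ ↦ by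
    rw [← natCast_zsmul]
    exact ha σ
  obtain ⟨b, rfl⟩ := exists_nsmul_eq_geomPrimaryTorsion W p hdiv a
  set φ' := φ - cobCocycle (G := H) b ((W.continuous_smul_geomPrimaryTorsion p b).comp continuous_subtype_val) with hφ'
  have hval : ∀ σ : H, p • φ'.1 σ = 0 := fun σ ↦ by
    change p • (φ.1 σ - ((σ : absoluteGaloisGroup K) • b - b)) = 0
    rw [smul_sub, ha', smul_sub, smul_comm, sub_self]
  have hmem : ∀ σ : H, ((φ'.1 σ : W.geomPrimaryTorsion p) : geomPoints W) ∈ geomTorsion W (p : ℤ) := fun σ ↦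
    AddSubgroup.torsionBy.nsmul_iff.mpr (by rw [← AddSubgroupClass.coe_nsmul, hval σ, ZeroMemClass.coe_zero])
  let χ : contOneCocycles (discreteTopRep H (geomTorsion W (p : ℤ))) :=
    contOneCocycles.lift (AddSubgroup.inclusion (geomTorsion_le_geomPrimaryTorsion W p))
      (fun _ _ ↦ rfl) (AddSubgroup.inclusion_injective _) φ' (fun σ ↦ ⟨_, hmem σ⟩) (fun _ ↦ rfl)
  refine ⟨oneCocycleClass _ χ, ?_⟩
  rw [resH1Hom_id_oneCocycleClass, contOneCocycles.push_lift, hφ', oneCocycleClass_sub, oneCocycleClass_cobCocycle,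
    sub_zero]

end Generic

/-! ## §2 Greenberg's local conditions are functorial in the coefficients `E[p] ↪ E[p^∞]` -/

section LocalConditions

variable {K : Type u} [Field K] [NumberField K] (W : WeierstrassCurve K) (p : ℕ) [Fact p.Prime]

omit [NumberField K] [Fact p.Prime] in
/-- `ι_*` commutes with restriction to a smaller subgroup. [cite: SerreGaloisCohomology1997, I §2.4 (compatible pairs)] -/
theorem resOfLe_coeffMap {H H' : Subgroup (absoluteGaloisGroup K)} (h : H ≤ H') (c : subgroupH1 H' (geomTorsion W (p : ℤ))) :
    resOfLe (W.geomPrimaryTorsion p) h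
        (resH1Hom (ContinuousMonoidHom.id H') (AddSubgroup.inclusion (geomTorsion_le_geomPrimaryTorsion W p))
          (fun _ _ ↦ rfl) c) =
      resH1Hom (ContinuousMonoidHom.id H) (AddSubgroup.inclusion (geomTorsion_le_geomPrimaryTorsion W p))
        (fun _ _ ↦ rfl) (resOfLe (geomTorsion W (p : ℤ)) h c) := by
  have e1 : (resOfLe (W.geomPrimaryTorsion p) h).comp
      (resH1Hom (ContinuousMonoidHom.id H') (AddSubgroup.inclusion (geomTorsion_le_geomPrimaryTorsion W p))
        (fun _ _ ↦ rfl)) =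
      resH1Hom (subgroupInclusion h) (AddSubgroup.inclusion (geomTorsion_le_geomPrimaryTorsion W p))
        (fun _ _ ↦ rfl) := by
    rw [Literature.NumberTheory.EllipticCurves.resOfLe, resH1Hom_comp]
    exact resH1Hom_congr (by ext; rfl) (by ext; rfl) _ _
  have e2 : (resH1Hom (ContinuousMonoidHom.id H) (AddSubgroup.inclusion (geomTorsion_le_geomPrimaryTorsion W p))
        (fun _ _ ↦ rfl)).comp (resOfLe (geomTorsion W (p : ℤ)) h) =
      resH1Hom (subgroupInclusion h) (AddSubgroup.inclusion (geomTorsion_le_geomPrimaryTorsion W p))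
        (fun _ _ ↦ rfl) := by
    rw [Literature.NumberTheory.EllipticCurves.resOfLe, resH1Hom_comp]
    exact resH1Hom_congr (by ext; rfl) (by ext; rfl) _ _
  have h1 := congrArg (fun f ↦ f c) e1
  have h2 := congrArg (fun f ↦ f c) e2
  simp only [AddMonoidHom.coe_comp, Function.comp_apply] at h1 h2
  rw [h1, h2]

omit [NumberField K] [Fact p.Prime] in
/-- `ι_*` commutes with the conjugation action `conj_σ` (`H` normal). [cite: SerreGaloisCohomology1997, I §2.5 (conjugation)] -/
theorem conjH1_coeffMap {H : Subgroup (absoluteGaloisGroup K)} [H.Normal] (σ : absoluteGaloisGroup K)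
    (c : subgroupH1 H (geomTorsion W (p : ℤ))) :
    conjH1 H (W.geomPrimaryTorsion p) σ
        (resH1Hom (ContinuousMonoidHom.id H) (AddSubgroup.inclusion (geomTorsion_le_geomPrimaryTorsion W p))
          (fun _ _ ↦ rfl) c) =
      resH1Hom (ContinuousMonoidHom.id H) (AddSubgroup.inclusion (geomTorsion_le_geomPrimaryTorsion W p))
        (fun _ _ ↦ rfl) (conjH1 H (geomTorsion W (p : ℤ)) σ c) := by
  have hcompat : ∀ (x : H) (m : geomTorsion W (p : ℤ)),
      ((DistribSMul.toAddMonoidHom (W.geomPrimaryTorsion p) σ).comp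
          (AddSubgroup.inclusion (geomTorsion_le_geomPrimaryTorsion W p))) (subgroupConj H σ x • m) =
        x • ((DistribSMul.toAddMonoidHom (W.geomPrimaryTorsion p) σ).comp
          (AddSubgroup.inclusion (geomTorsion_le_geomPrimaryTorsion W p))) m := by
    intro x m
    have hincl : ∀ (g : absoluteGaloisGroup K) (m : geomTorsion W (p : ℤ)),
        AddSubgroup.inclusion (geomTorsion_le_geomPrimaryTorsion W p) (g • m) =
          g • AddSubgroup.inclusion (geomTorsion_le_geomPrimaryTorsion W p) m := fun _ _ ↦ rfl
    simp only [AddMonoidHom.coe_comp, Function.comp_apply, DistribSMul.toAddMonoidHom_apply, Subgroup.smul_def,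
      subgroupConj_apply_coe, hincl, smul_smul]
    congr 1
    group
  have e1 : (conjH1 H (W.geomPrimaryTorsion p) σ).comp
      (resH1Hom (ContinuousMonoidHom.id H) (AddSubgroup.inclusion (geomTorsion_le_geomPrimaryTorsion W p))
        (fun _ _ ↦ rfl)) =
      resH1Hom (subgroupConj H σ) ((DistribSMul.toAddMonoidHom (W.geomPrimaryTorsion p) σ).comp
        (AddSubgroup.inclusion (geomTorsion_le_geomPrimaryTorsion W p))) hcompat := by
    rw [Literature.NumberTheory.EllipticCurves.conjH1, resH1Hom_comp]
    exact resH1Hom_congr (by ext; rfl) (by ext; rfl) _ _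
  have e2 : (resH1Hom (ContinuousMonoidHom.id H) (AddSubgroup.inclusion (geomTorsion_le_geomPrimaryTorsion W p))
        (fun _ _ ↦ rfl)).comp (conjH1 H (geomTorsion W (p : ℤ)) σ) =
      resH1Hom (subgroupConj H σ) ((DistribSMul.toAddMonoidHom (W.geomPrimaryTorsion p) σ).comp
        (AddSubgroup.inclusion (geomTorsion_le_geomPrimaryTorsion W p))) hcompat := by
    rw [Literature.NumberTheory.EllipticCurves.conjH1, resH1Hom_comp]
    exact resH1Hom_congr (by ext; rfl) (by ext; rfl) _ _
  have h1 := congrArg (fun f ↦ f c) e1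
  have h2 := congrArg (fun f ↦ f c) e2
  simp only [AddMonoidHom.coe_comp, Function.comp_apply] at h1 h2
  rw [h1, h2]

omit [Fact p.Prime] in
/-- `ι_*` carries "locally trivial above `v`" for `E[p]` into the same for `E[p^∞]`. [cite: Greenberg1989, §1 p. 98] -/
theorem coeffMap_mem_awayKer {H : Subgroup (absoluteGaloisGroup K)} (v : HeightOneSpectrum (𝓞 K))
    {c : subgroupH1 H (geomTorsion W (p : ℤ))} (hc : c ∈ awayKer H (geomTorsion W (p : ℤ)) v) :
    resH1Hom (ContinuousMonoidHom.id H) (AddSubgroup.inclusion (geomTorsion_le_geomPrimaryTorsion W p))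
      (fun _ _ ↦ rfl) c ∈ awayKer H (W.geomPrimaryTorsion p) v := by
  rw [awayKer, AddMonoidHom.mem_ker] at hc ⊢
  rw [resOfLe_coeffMap, hc, map_zero]

omit [NumberField K] [Fact p.Prime] in
/-- `ι_*` carries "locally trivial at the infinite place `w`" for `E[p]` into the same for `E[p^∞]`. [cite: Greenberg1989, §1 p. 98 (3)] -/
theorem coeffMap_mem_infKer {H : Subgroup (absoluteGaloisGroup K)} (w : InfinitePlace K)
    {c : subgroupH1 H (geomTorsion W (p : ℤ))} (hc : c ∈ infKer H (geomTorsion W (p : ℤ)) w) :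
    resH1Hom (ContinuousMonoidHom.id H) (AddSubgroup.inclusion (geomTorsion_le_geomPrimaryTorsion W p))
      (fun _ _ ↦ rfl) c ∈ infKer H (W.geomPrimaryTorsion p) w := by
  rw [infKer, AddMonoidHom.mem_ker] at hc ⊢
  rw [resOfLe_coeffMap, hc, map_zero]

omit [Fact p.Prime] in
/-- **`ι_* : Sel₀(L, E[p]) → Sel₀(L, E[p^∞])`** — Greenberg's STRICT fine Selmer group over `L = K̄^H` (`H` normal) with
`E[p]`-coefficients maps into the one with `E[p^∞]`-coefficients (local conditions are functorial; the fine strict condition above `p`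
is "locally trivial", `LocalAway.strictKer_fineLocalDatum_eq_awayKer`). [cite: Greenberg1989, §1 p. 98] [cite: CoatesSujatha2005, §3] -/
theorem coeffMap_mem_strictSelmerGroupOver_fine {H : Subgroup (absoluteGaloisGroup K)} [H.Normal]
    {c : subgroupH1 H (geomTorsion W (p : ℤ))}
    (hc : c ∈ strictSelmerGroupOver H (geomTorsion W (p : ℤ)) p (fineData (geomTorsion W (p : ℤ)) p)) :
    resH1Hom (ContinuousMonoidHom.id H) (AddSubgroup.inclusion (geomTorsion_le_geomPrimaryTorsion W p))
      (fun _ _ ↦ rfl) c ∈ strictSelmerGroupOver H (W.geomPrimaryTorsion p) p (fineData (W.geomPrimaryTorsion p) p) := by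
  have hc' := (mem_strictSelmerGroupOver_iff (H := H) (M := geomTorsion W (p : ℤ))
    (L := fineData (geomTorsion W (p : ℤ)) p) c).1 hc
  refine (mem_strictSelmerGroupOver_iff (H := H) (M := W.geomPrimaryTorsion p)
    (L := fineData (W.geomPrimaryTorsion p) p) _).2 ⟨fun v hv σ ↦ ?_, fun w σ ↦ ?_, fun v hv σ ↦ ?_⟩
  · rw [conjH1_coeffMap]
    exact coeffMap_mem_awayKer W p v (hc'.1 v hv σ)
  · rw [conjH1_coeffMap]
    exact coeffMap_mem_infKer W p w (hc'.2.1 w σ)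
  · change _ ∈ (fineLocalDatum (W.geomPrimaryTorsion p) v).strictKer _
    rw [LocalAway.strictKer_fineLocalDatum_eq_awayKer, conjH1_coeffMap]
    have h2 := hc'.2.2 v hv σ
    change _ ∈ (fineLocalDatum (geomTorsion W (p : ℤ)) v).strictKer _ at h2
    rw [LocalAway.strictKer_fineLocalDatum_eq_awayKer] at h2
    exact coeffMap_mem_awayKer W p v h2

omit [Fact p.Prime] in
/-- The relaxed-at-`∞` twin: `ι_* : Sel₀^{rel ∞}(L, E[p]) → Sel₀^{rel ∞}(L, E[p^∞])`. [cite: GreenbergLNM1716, §4 (PDF p. 106)] -/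
theorem coeffMap_mem_strictSelmerGroupOverRelaxedInf_fine {H : Subgroup (absoluteGaloisGroup K)} [H.Normal]
    {c : subgroupH1 H (geomTorsion W (p : ℤ))}
    (hc : c ∈ strictSelmerGroupOverRelaxedInf H (geomTorsion W (p : ℤ)) p (fineData (geomTorsion W (p : ℤ)) p)) :
    resH1Hom (ContinuousMonoidHom.id H) (AddSubgroup.inclusion (geomTorsion_le_geomPrimaryTorsion W p))
      (fun _ _ ↦ rfl) c ∈
      strictSelmerGroupOverRelaxedInf H (W.geomPrimaryTorsion p) p (fineData (W.geomPrimaryTorsion p) p) := by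
  have hc' := (mem_strictSelmerGroupOverRelaxedInf_iff (H := H) (M := geomTorsion W (p : ℤ))
    (L := fineData (geomTorsion W (p : ℤ)) p) c).1 hc
  refine (mem_strictSelmerGroupOverRelaxedInf_iff (H := H) (M := W.geomPrimaryTorsion p)
    (L := fineData (W.geomPrimaryTorsion p) p) _).2 ⟨fun v hv σ ↦ ?_, fun v hv σ ↦ ?_⟩
  · rw [conjH1_coeffMap]
    exact coeffMap_mem_awayKer W p v (hc'.1 v hv σ)
  · change _ ∈ (fineLocalDatum (W.geomPrimaryTorsion p) v).strictKer _
    rw [LocalAway.strictKer_fineLocalDatum_eq_awayKer, conjH1_coeffMap]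
    have h2 := hc'.2 v hv σ
    change _ ∈ (fineLocalDatum (geomTorsion W (p : ℤ)) v).strictKer _ at h2
    rw [LocalAway.strictKer_fineLocalDatum_eq_awayKer] at h2
    exact coeffMap_mem_awayKer W p v h2

end LocalConditions

/-! ## §3 `K = ℚ`, `p = 2`, the cyclotomic `ℤ₂`-extension: `E(ℚ_∞)[2^∞] = 0` and the necessity half of PERFECT DESCENT (v) -/

section RatTwo

open Literature.NumberTheory.EllipticCurves.Greenberg1999

variable (W : WeierstrassCurve ℚ) [W.IsElliptic] (κ : ZpExtension ℚ 2)

/-- **`E(ℚ_∞)[2^∞] = 0`** for the cyclotomic `ℤ₂`-extension `ℚ_∞` and `E/ℚ` WITHOUT a rational point of order `2`: a point fixed by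
`ker κ ⊇ ker χ₂` is fixed by `ker χ₂`, and `E(ℚ(ζ_{2^∞}))[2^∞] = 0` (att-p4 g3 `CycTorsion.fixedPoints_kerCyclotomicCharacter_geomPrimaryTorsion_eq_bot`).
[cite: Ribet1981CyclotomicTorsion, Thm. 1, pp. 315–316] -/
theorem smul_eq_self_kerSubgroup_imp_eq_zero (hκ : κ.IsCyclotomic) (ht : ∀ x : ℚ, ¬ HasRationalTwoTorsionX W x)
    (m : W.geomPrimaryTorsion 2) (hm : ∀ h : κ.kerSubgroup, h • m = m) : m = 0 := by
  have hmem : m ∈ FixedPoints.addSubgroup (GaloisRep.cyclotomicCharacter ℚ 2).toMonoidHom.ker (W.geomPrimaryTorsion 2) := by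
    rw [FixedPoints.mem_addSubgroup]
    intro h
    have := hm ⟨(h : absoluteGaloisGroup ℚ), InfRes.ker_cyclotomicCharacter_le_kerSubgroup κ hκ h.2⟩
    rw [Subgroup.smul_def] at this ⊢
    exact this
  rw [CycTorsion.fixedPoints_kerCyclotomicCharacter_geomPrimaryTorsion_eq_bot W ht] at hmem
  exact (AddSubgroup.mem_bot).mp hmem

/-- **`ι_* : H¹(ℚ_∞, E[2]) → H¹(ℚ_∞, E[2^∞])` is INJECTIVE** (cyclotomic `ℤ₂`-extension, no rational `2`-torsion point).
PERFECT-DESCENT §3 (v). [cite: GreenbergLNM1716, §5 p. 114] -/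
theorem coeffMap_injective_rat_two (hκ : κ.IsCyclotomic) (ht : ∀ x : ℚ, ¬ HasRationalTwoTorsionX W x) :
    Function.Injective (resH1Hom (ContinuousMonoidHom.id κ.kerSubgroup)
      (AddSubgroup.inclusion (geomTorsion_le_geomPrimaryTorsion W 2)) (fun _ _ ↦ rfl) :
        subgroupH1 κ.kerSubgroup (geomTorsion W ((2 : ℕ) : ℤ)) →+ subgroupH1 κ.kerSubgroup (W.geomPrimaryTorsion 2)) :=
  coeffMap_injective_of_fixedPoints W 2 κ.kerSubgroup (smul_eq_self_kerSubgroup_imp_eq_zero W κ hκ ht)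

/-- **`ι_*(H¹(ℚ_∞, E[2])) = H¹(ℚ_∞, E[2^∞])[2]`** (cyclotomic `ℤ₂`-extension): with the injectivity, `H¹(ℚ_∞, E[2]) ≅ H¹(ℚ_∞, E[2^∞])[2]`.
PERFECT-DESCENT §3 (v). [cite: GreenbergLNM1716, §5 p. 114 (proof of Prop. 5.8)] -/
theorem range_coeffMap_rat_two :
    Set.range (resH1Hom (ContinuousMonoidHom.id κ.kerSubgroup)
      (AddSubgroup.inclusion (geomTorsion_le_geomPrimaryTorsion W 2)) (fun _ _ ↦ rfl) :
        subgroupH1 κ.kerSubgroup (geomTorsion W ((2 : ℕ) : ℤ)) →+ subgroupH1 κ.kerSubgroup (W.geomPrimaryTorsion 2)) =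
      {x | 2 • x = 0} := by
  ext x
  constructor
  · rintro ⟨y, rfl⟩
    exact nsmul_coeffMap_eq_zero W 2 κ.kerSubgroup y
  · intro hx
    exact exists_coeffMap_eq_of_nsmul_eq_zero W 2 κ.kerSubgroup hx

/-- **NECESSITY half of PERFECT-DESCENT (v): statement (A)₂ ⟹ `Sel₀(ℚ_∞, E[2])` is FINITE.** For `E/ℚ` with no rational point of
order `2` and the cyclotomic `ℤ₂`-extension: if `Sel₀(ℚ_∞, E[2^∞])[2]` is finite, then Greenberg's strict fine Selmer group of
`E[2]` over `ℚ_∞` (classes in `H¹(ℚ_∞, E[2])` locally trivial at every place; = `Hom_{G_∞}(X_{Σ-cs}(ℚ(E[2])_∞), E[2])` by the lead's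
inf–res + class field theory, PERFECT-DESCENT §3 (ii)) is finite: `ι_*` embeds it into the former.
[cite: GreenbergLNM1716, §5 p. 114] [cite: CoatesSujatha2005, §3 (statement (A))] -/
theorem finite_fineSelmer_twoCoeff_of_finite_twoTorsion (hκ : κ.IsCyclotomic)
    (ht : ∀ x : ℚ, ¬ HasRationalTwoTorsionX W x) (hA : Set.Finite {s : W.fineSelmerInfty κ | 2 • s = 0}) :
    Set.Finite (strictSelmerGroupOver κ.kerSubgroup (geomTorsion W ((2 : ℕ) : ℤ)) 2
      (fineData (geomTorsion W ((2 : ℕ) : ℤ)) 2) : Set (subgroupH1 κ.kerSubgroup (geomTorsion W ((2 : ℕ) : ℤ)))) := by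
  set ι := (resH1Hom (ContinuousMonoidHom.id κ.kerSubgroup)
      (AddSubgroup.inclusion (geomTorsion_le_geomPrimaryTorsion W 2)) (fun _ _ ↦ rfl) :
        subgroupH1 κ.kerSubgroup (geomTorsion W ((2 : ℕ) : ℤ)) →+ subgroupH1 κ.kerSubgroup (W.geomPrimaryTorsion 2)) with hι
  -- the image lies in the finite set `(Sel₀[2] : Set H¹(ℚ_∞, E[2^∞]))`
  have himg : (ι '' (strictSelmerGroupOver κ.kerSubgroup (geomTorsion W ((2 : ℕ) : ℤ)) 2
      (fineData (geomTorsion W ((2 : ℕ) : ℤ)) 2) : Set _)).Finite := by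
    refine ((hA.image (fun s : W.fineSelmerInfty κ ↦ (s : W.subgroupH1 2 κ.kerSubgroup))).subset ?_)
    rintro _ ⟨c, hc, rfl⟩
    have hmem : ι c ∈ W.fineSelmerInfty κ := coeffMap_mem_strictSelmerGroupOver_fine W 2 hc
    refine ⟨⟨ι c, hmem⟩, ?_, rfl⟩
    change (2 • (⟨ι c, hmem⟩ : W.fineSelmerInfty κ)) = 0
    exact Subtype.ext (by rw [AddSubmonoidClass.coe_nsmul, ZeroMemClass.coe_zero]; exact nsmul_coeffMap_eq_zero W 2 _ c)
  exact Set.Finite.of_finite_image himg (coeffMap_injective_rat_two W κ hκ ht).injOn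

/-- Relaxed-at-`∞` twin: (A)₂^{rel ∞} ⟹ `Sel₀^{rel ∞}(ℚ_∞, E[2])` finite (= `Hom_{G_∞}(X⁺_{Σ-cs}, E[2])`, PERFECT-DESCENT (b)).
[cite: GreenbergLNM1716, §4 Lemma 4.6 (PDF pp. 106–107)] -/
theorem finite_fineSelmerRelaxed_twoCoeff_of_finite_twoTorsion (hκ : κ.IsCyclotomic)
    (ht : ∀ x : ℚ, ¬ HasRationalTwoTorsionX W x)
    (hA : Set.Finite {s : W.fineSelmerInftyRelaxedInf κ | 2 • s = 0}) :
    Set.Finite (strictSelmerGroupOverRelaxedInf κ.kerSubgroup (geomTorsion W ((2 : ℕ) : ℤ)) 2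
      (fineData (geomTorsion W ((2 : ℕ) : ℤ)) 2) : Set (subgroupH1 κ.kerSubgroup (geomTorsion W ((2 : ℕ) : ℤ)))) := by
  set ι := (resH1Hom (ContinuousMonoidHom.id κ.kerSubgroup)
      (AddSubgroup.inclusion (geomTorsion_le_geomPrimaryTorsion W 2)) (fun _ _ ↦ rfl) :
        subgroupH1 κ.kerSubgroup (geomTorsion W ((2 : ℕ) : ℤ)) →+ subgroupH1 κ.kerSubgroup (W.geomPrimaryTorsion 2)) with hι
  have himg : (ι '' (strictSelmerGroupOverRelaxedInf κ.kerSubgroup (geomTorsion W ((2 : ℕ) : ℤ)) 2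
      (fineData (geomTorsion W ((2 : ℕ) : ℤ)) 2) : Set _)).Finite := by
    refine ((hA.image (fun s : W.fineSelmerInftyRelaxedInf κ ↦ (s : W.subgroupH1 2 κ.kerSubgroup))).subset ?_)
    rintro _ ⟨c, hc, rfl⟩
    have hmem : ι c ∈ W.fineSelmerInftyRelaxedInf κ := coeffMap_mem_strictSelmerGroupOverRelaxedInf_fine W 2 hc
    refine ⟨⟨ι c, hmem⟩, ?_, rfl⟩
    change (2 • (⟨ι c, hmem⟩ : W.fineSelmerInftyRelaxedInf κ)) = 0
    exact Subtype.ext (by rw [AddSubmonoidClass.coe_nsmul, ZeroMemClass.coe_zero]; exact nsmul_coeffMap_eq_zero W 2 _ c)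
  exact Set.Finite.of_finite_image himg (coeffMap_injective_rat_two W κ hκ ht).injOn

end RatTwo

end Summit.BirchSwinnertonDyer.BirchSwinnertonDyer.Theorems.AlignedTransportAtTwoFineRoad.TorsionCoefficients

end
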